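import Mathlib
import Literature.MathematicalPhysics.QuantumFieldTheory.Balaban1983to89.TreeLengthTorusTransfer
import Literature.MathematicalPhysics.QuantumFieldTheory.Balaban1983to89.B13Geometry236

/-!
# `Balaban1983to89.TreeLengthTorusGeometry236` — [Balaban1988RG2Cluster] p. 19, the scale-transfer inequality (2.36)
"2d_k(Z_i) ≧ Ld_{k+1}(Z′_i)" ON THE TORUS: the cell's certified substitute L·d_{k+1}(Z′) ≤ (3 + 4/(L − 2))·d_k(Z̄)
PROVED IN THE KERNEL for the torus tree length `torusTreeLen` between the two torus catalogues 𝐃_k (L·N′ cubes per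
direction) and 𝐃_{k+1} (N′ blocks per direction), every d, every L ≥ 3; hence (2.36)_ℓ for the periodic carrier,
`B13.Ineq236With (tsys d (L·N′)) (tsys d N′) (Z ↦ Z′) (L/a(L))`, with ℓ = L/a(L) > 1 for L ≥ 5

CITATION HEADER (lean-in-tree rule 2026-08-18).  Sources under audit: T. Bałaban, *Renormalization group approach to
lattice gauge field theories. II. Cluster expansions*, Commun. Math. Phys. **116**, 1–22 (1988), doi:10.1007/bf01239022
[Balaban1988RG2Cluster] (cell paper B13; journal page = PDF page; p. 13, (2.36) p. 19, p. 20 ll. 2–3), together with the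
definitions of part I, Commun. Math. Phys. **109**, 249–301 (1987) [Balaban1987RG1] (cell paper B12; p. 251 = PDF p. 3:
the torus and "L is an odd, positive integer > 11"; p. 257 = PDF p. 9: cubes, □̃ⁿ, X̃ⁿ, the linear size d_j).  The
sentences quoted below were re-read this session on the renders `1988-cmp116-rg-II-cluster-p013-x2.png`, `…-p019-x2.png`,
`…-p020-x2.png`, `1987-cmp109-rg-I-small-field-p003-x2.png`, `…-p009-x2.png` (read as images) and are ALSO quoted
verbatim — and were cross-read (cell GAPS.md C-pv22-2, C-pv23-4, C-pv27-2, C-pv18-11, C-pv11-1) — in the imported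
modules `…Balaban1983to89.B13` Part F (`Ineq236With`, `exp_transfer_of_ineq236With`, `ineq236With_of_pointwise`,
`Consts.aL`), `…Balaban1983to89.B13ScaleTransfer` (unit pv11: the window index model `Pt`, `block` = □̃, `collar` = X̃,
`coarse`, `closureIdx`), `…Balaban1983to89.B13Geometry236` (unit pv11 gen 2: THE WINDOW VERSION of everything below —
`exists_common_point`, `snap`, `snap_dist_le`, `snap_mem_cube`, `exists_corner_point`, `sub_two_le_len`,
`exists_admissible_closure`, `geometry236_treeLen`, `a236`, `a236_pos`, `a236_le_aL`, `a236_lt_self`,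
`one_lt_transferFactor`, `transferFactor_thirteen`, `ineq236With_window`), `…Balaban1983to89.TreeLength` (unit pv22:
`cube`, `Seg`, `carrier`, `len`, `lenIn`, `le_lenIn_closedBall`, `sum_lenIn_le_len`, `exists_max_image`,
`isConnected_union_carrier`, `len_map_le`, `scaleSeg`), `…Balaban1983to89.TreeLengthTorus` (unit pv22 gen 2: the
periodic index model `TPt d N = (ℤ/N)^d`, `proj`, `natLift`, `liftCubes`, `TAdmissible`, `torusTreeLen`, `TDom`,
`tsys`), `…Balaban1983to89.TreeLengthTorusGeometry` (pv22 gen 2: deck transformations `period`,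
`exists_period_of_proj_eq`, `finset_nonempty_of_tAdmissible`) and `…Balaban1983to89.TreeLengthTorusTransfer` (pv22
gen 3: two nested tori N = L·N′, the block map `tcoarse`, `tcoarse_proj`, □̃/X̃ on the torus `tblock`/`tcollar`,
Z ↦ Z′ = `tclosure`, `tclosureDom`, `tAdmissible_scale`, the affine substitute `scaleTransfer_torus_sharp`).  Cell
records: GAPS.md G-B13-09 / G-B13-09R / C-B13-09 ((2.36) unproved in print; the cell's certified substitutes),
DIVERGENCE D-b13.9 (transfer factor), D-pv22.1 (conventions of the tree length), D-pv22g2.1 (covering-space reading of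
d_j on the torus), D-pv22.3 / D-pv22g2.2 / D-pv22g3.1 (window versus torus: after `…TreeLengthTorusTransfer` the ONLY
window-only leaf left was the geometry factor a(L) — THIS module ports it); unit `b2b-balaban-pv22` gen 3 (surge node
prover #22), journal claim TORUS-GEOM236-KERNEL.  Imports `…TreeLengthTorusTransfer` and `…B13Geometry236` only;
nothing existing is modified.  What is proved is NOT a statement of the audited papers: it is the cell's own elementary
substitute for the unproved printed step (2.36), now on the papers' periodic carrier.

WHAT THE PAPER PRINTS.  [Balaban1988RG2Cluster] p. 19 [PDF 19], verbatim: *"we denote by Z′_i the smallest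
localization domain from 𝐃_{k+1} containing Z̃_i"* and *"The remaining exponential is bounded using the following
inequality: 2d_k(Z_i) ≧ Ld_{k+1}(Z′_i). (2.36) This inequality can be obtained by simple, but awkward, geometric and
combinatoric considerations. It follows by considering locally many possible cases."*; its single use, p. 20 ll. 2–3,
verbatim: *"and (1 − 5δ)κd_k(Z_i) in the exponentials replaced by (1 − 6δ)½Lκd_{k+1}(Z′_i)"*; p. 13, verbatim: *"we
take cubes from π_{k+1}, i.e. cubes of the size LM in the scale corresponding to the lattice T_η"*.  [Balaban1987RG1]
p. 257, verbatim: *"For a cube □ ∈ π_j and n = 1, 2, … we define □̃ⁿ as a cube of the size (1 + 2n)M and with a center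
at the center of □."*, *"The meaning of the symbol X̃ⁿ should be obvious."*, *"Consider a class of tree graphs contained
in X and intersecting all the cubes in X. A length of a shortest graph in this class, divided by M, is the linear size
of X, and is denoted by d_j(X)."* — on the carrier of p. 251, verbatim: *"a torus T obtained by the usual identification
of boundary points of the cube"*, with *"L is an odd, positive integer > 11"* (p. 251).  In the periodic index model
(READING D-pv22g2.1 / D-pv22g3.1): Z̄ ⊆ `TPt d (L·N′)` non-empty and torus-face-connected (a localization domain from
𝐃_k of the torus), Z̃ = `tcollar Z`, Z′ = `tclosure L N′ Z` ⊆ `TPt d N′` (the π_{k+1}-blocks of the SAME torus met by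
Z̃), d_k = `torusTreeLen` (graphs in the universal cover ℝ^d meeting, for every cube of the family, some lift of it).

WHAT IS PROVED HERE (kernel-checked, zero `sorry`; every input is a theorem of the imported cell modules or of
Mathlib).  MAIN THEOREM `geometry236_torusTreeLen`: for every d, every L ≥ 3, every N′ ≥ 1 and every non-empty
torus-face-connected Z̄ ⊆ TPt d (L·N′),
  L · torusTreeLen (tclosure L N′ Z) ≤ (3 + 4/(L − 2)) · torusTreeLen Z̄,
i.e. with `B13Geometry236.a236` (`geometry236_torusTreeLen_a236`); d = 4, L = 13 (the least admitted block size):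
13 · d_{k+1}(Z′) ≤ (37/11) · d_k(Z̄) (`geometry236_torus_thirteen`); the exponential form of pp. 19–20
(`exp_transfer_torus_geometry`).  Part 5 — **(2.36)_ℓ FOR THE TORUS CATALOGUES**: `ineq236With_torus :
B13.Ineq236With (tsys d (L·N′)) (tsys d N′) (tclosureDom L N′) (L / a236 L)` for every L ≥ 3 (via
`B13.ineq236With_of_pointwise`), the weaker prose factor `ineq236With_torus_aL` (ℓ = L / B13.Consts.aL L), its single
printed use `exp_transfer_tsys` (= `B13.exp_transfer_of_ineq236With` on the torus catalogues), and d = 4, L = 13: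
`ineq236With_torus_thirteen : B13.Ineq236With (tsys 4 (13·N′)) (tsys 4 N′) (tclosureDom 13 N′) (143/37)` (transfer
factor 3.86…; printed ½L = 6.5).  Since L/a236 L > 1 iff L ≥ 5 (`B13Geometry236.one_lt_transferFactor`), the transfer
input behind Lemma 3_ℓ (the parameter ℓ of `B13.Lemma3With`, `B13.Consts.R22gen`, `TreeLengthTorusGeometry.
deliverables_torus`) is now a THEOREM with ℓ > 1 on the PERIODIC carrier for every L admitted by p. 251 — the torus
twin of `B13Geometry236.ineq236With_window`.

THE PROOF (pv11 gen 2's separated-net / whisker argument, run in the universal cover; the new work is the choice of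
LIFTS).  Fix a torus-admissible graph T for Z̄: connected, and for every ā ∈ Z̄ a lift X(ā) ∈ ℤ^d, proj X(ā) = ā, and a
point t(ā) ∈ T ∩ cube X(ā).  (0) LIFTING Z̃ AND Z′ THROUGH X (Part 2): every cell c ∈ Z′ is `proj_{N′} (coarse L y)`
for some ā ∈ Z̄ and some window cube y ∈ □̃(X ā) (`exists_lift_of_mem_tclosure`, from `exists_block_lift`: □̃ on the
torus was defined through the standard lift `natLift`, and any two lifts differ by a deck transformation
`exists_period_of_proj_eq`, which permutes □̃ and commutes with `coarse`, `coarse_add_period`); conversely every such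
`proj (coarse L y)` lies in Z′ (`proj_coarse_mem_tclosure`).  So the finite window family
Y := {coarse L y : ā ∈ Z̄, y ∈ □̃(X ā)} ⊆ ℤ^d projects ONTO Z′, and a graph meeting every unit cube of Y is
torus-admissible for Z′.  (1) "Two scales apart" (`sub_two_le_len_of_points`, from pv22's capture lemma
`le_lenIn_closedBall`): if two cells of Y are ≥ 2 apart in some coordinate then, by the corner points of (2), T contains
two points ≥ L − 2 apart in that coordinate, so |T| ≥ L − 2; otherwise all cubes of Y have a common point q
(`B13Geometry236.exists_common_point`) and the one-point graph [(q,q)] is torus-admissible for Z′ (`tAdmissible_point`),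
so torusTreeLen Z′ = 0 (`mul_torusTreeLen_tclosure_le`, second branch).  (2) CORNER POINTS
(`exists_corner_point_of_mem_block` = pv11-g2's `exists_corner_point` for one pair of touching cubes): the rescaled
cell (coarse L y)/… contains a point within 1/L of the rescaled witness point t(ā)/L.  (3)–(5) NET, WHISKERS,
ACCOUNTING exactly as in `B13Geometry236.exists_admissible_closure` (pv22's `exists_max_image` for the maximal
2r-separated subfamily S ⊆ Z̄ of witness points, disjoint balls B̄(t(s)/L, r) capturing ≥ r of T/L each when |S| ≥ 2,
whiskers to `snap R (t(s)/L)` with R = 2r + 1/L < ½, `snap_mem_cube`): `exists_tAdmissible_closure` gives a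
torus-admissible T′ for Z′ with L·|T′| ≤ 3|T| + |T|/(rL) whenever |T| ≥ L − 2 and 4r + 2/L < 1; the infimum over T
and r ↑ (L − 2)/(4L) (`le_mul_torusTreeLen`, `mul_torusTreeLen_tclosure_le`) give the theorem.  Part 5 is bookkeeping:
`tclosureDom_val`, `B13.ineq236With_of_pointwise (a236_pos _)`.

WHAT IS *NOT* CLAIMED.  (i) The printed (2.36) itself (factor exactly ½L, no additive constant): UNPROVED in print,
false for L ≤ 5 (G-B13-09 (i)), undecided for the L in force, and not needed (ℓ > 1 suffices for pp. 19–21,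
`B13.Consts.delta_pos_iff_of_R22gen`).  (ii) L ∣ N is built in (fine torus `TPt d (L·N′)`): the papers' situation
(p. 251: the lattices have 2L^{m+K−j}… sites per direction, cubes of side M = L^m; D-pv22g3.1 (i)), not an extra
hypothesis on them.  (iii) Only the sup-metric torus tree length `torusTreeLen` is treated, with pv22's conventions
D-pv22.1 and the covering-space READING D-pv22g2.1; for N′ ≤ 2 torus adjacency degenerates and every statement stays
true as typed.  (iv) Nothing about Lemma 3 (an ANALYTIC hypothesis `B13.Lemma3With` of `deliverables_torus`), the
R-operation or the series: this module only turns the GEOMETRIC transfer input (2.36)_ℓ into a theorem on the periodic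
carrier.  Value = kernel-checked carrier migration of the cell's certified (2.36) substitute to the papers' torus
(closes the last window-only leaf recorded in DIVERGENCE D-pv22.3), NOT summit progress.
-/

namespace Literature.MathematicalPhysics.QuantumFieldTheory.Balaban1983to89.TreeLengthTorusGeometry236

noncomputable section

open Literature.MathematicalPhysics.QuantumFieldTheory.Balaban1983to89
open Literature.MathematicalPhysics.QuantumFieldTheory.Balaban1983to89.B13ScaleTransfer
open Literature.MathematicalPhysics.QuantumFieldTheory.Balaban1983to89.TreeLength
open Literature.MathematicalPhysics.QuantumFieldTheory.Balaban1983to89.TreeLengthTorus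
open Literature.MathematicalPhysics.QuantumFieldTheory.Balaban1983to89.TreeLengthTorusGeometry
open Literature.MathematicalPhysics.QuantumFieldTheory.Balaban1983to89.TreeLengthTorusTransfer
open Literature.MathematicalPhysics.QuantumFieldTheory.Balaban1983to89.B13Geometry236

variable {d : ℕ} {N : ℕ}

/-! ## Part 1. Window complements: the corner point of two touching cubes, "two scales apart" from two points -/

/-- The corner point of pv11-g2's `exists_corner_point`, for ONE pair of touching cubes: if y ∈ □̃(z) then the cell
`coarse L y` (rescaled to a unit cube) contains a point q such that the image under p ↦ p/L of every point of the cube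
z is within 1/L of q (`B13Geometry236.exists_corner_point` applied to the one-cube family {z}). [folklore] -/
theorem exists_corner_point_of_mem_block {L : ℕ} (hL : 0 < L) {y z : Pt d} (hy : y ∈ B13ScaleTransfer.block z) :
    ∃ q ∈ cube (coarse L y), ∀ P ∈ cube z, dist q ((L : ℝ)⁻¹ • P) ≤ 1 / (L : ℝ) := by
  have hc : coarse L y ∈ closureIdx L (collar ({z} : Finset (Pt d))) := by
    unfold closureIdx collar
    refine Finset.mem_image_of_mem _ ?_
    rw [Finset.singleton_biUnion]
    exact hy
  obtain ⟨z', hz', q, hq, h⟩ := exists_corner_point hL hc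
  rw [Finset.mem_singleton] at hz'
  subst hz'
  exact ⟨q, hq, h⟩

/-- TWO SCALES APART from two points (the computation of `B13Geometry236.sub_two_le_len`, detached from the window
carrier): if a connected polygonal graph T contains points t₁, t₂ whose images under p ↦ p/L are within 1/L of points
q₁ ∈ cube c₁, q₂ ∈ cube c₂ of two cells at index distance ≥ 2 in some coordinate, then |T| ≥ L − 2 (pv22's capture
lemma `le_lenIn_closedBall`). [folklore] -/
theorem sub_two_le_len_of_points {L : ℕ} (hL : 3 ≤ L) {T : List (Seg d)} (hT : IsPreconnected (carrier T))
    {t₁ t₂ : RPt d} (ht₁ : t₁ ∈ carrier T) (ht₂ : t₂ ∈ carrier T) {c₁ c₂ : Pt d} {q₁ q₂ : RPt d}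
    (hq₁ : q₁ ∈ cube c₁) (hq₂ : q₂ ∈ cube c₂) (h₁ : dist q₁ ((L : ℝ)⁻¹ • t₁) ≤ 1 / (L : ℝ))
    (h₂ : dist q₂ ((L : ℝ)⁻¹ • t₂) ≤ 1 / (L : ℝ)) {μ : Fin d} (hfar : c₁ μ + 2 ≤ c₂ μ) :
    (L : ℝ) - 2 ≤ len T := by
  have hL0 : 0 < L := by omega
  have hLr : (0 : ℝ) < L := by exact_mod_cast hL0
  have hLne : (L : ℝ) ≠ 0 := hLr.ne'
  have hL3 : (3 : ℝ) ≤ L := by exact_mod_cast hL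
  have d₁ : |q₁ μ - (L : ℝ)⁻¹ * t₁ μ| ≤ 1 / L := by
    have := (dist_le_pi_dist q₁ ((L : ℝ)⁻¹ • t₁) μ).trans h₁
    rwa [Real.dist_eq, Pi.smul_apply, smul_eq_mul] at this
  have d₂ : |q₂ μ - (L : ℝ)⁻¹ * t₂ μ| ≤ 1 / L := by
    have := (dist_le_pi_dist q₂ ((L : ℝ)⁻¹ • t₂) μ).trans h₂
    rwa [Real.dist_eq, Pi.smul_apply, smul_eq_mul] at this
  have hq₁μ : q₁ μ ≤ (c₁ μ : ℝ) + 1 := ((mem_cube.1 hq₁) μ).2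
  have hq₂μ : (c₂ μ : ℝ) ≤ q₂ μ := ((mem_cube.1 hq₂) μ).1
  have hfar' : (c₁ μ : ℝ) + 2 ≤ (c₂ μ : ℝ) := by exact_mod_cast hfar
  rw [abs_le] at d₁ d₂
  have key : (L : ℝ) - 2 ≤ t₂ μ - t₁ μ := by
    have b1 : (L : ℝ)⁻¹ * t₁ μ ≤ (c₁ μ : ℝ) + 1 + 1 / L := by linarith [d₁.1]
    have b2 : (c₂ μ : ℝ) - 1 / L ≤ (L : ℝ)⁻¹ * t₂ μ := by linarith [d₂.2]
    have b1' := mul_le_mul_of_nonneg_left b1 hLr.le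
    have b2' := mul_le_mul_of_nonneg_left b2 hLr.le
    have a1 : (L : ℝ) * ((L : ℝ)⁻¹ * t₁ μ) = t₁ μ := by rw [← mul_assoc, mul_inv_cancel₀ hLne, one_mul]
    have a2 : (L : ℝ) * ((L : ℝ)⁻¹ * t₂ μ) = t₂ μ := by rw [← mul_assoc, mul_inv_cancel₀ hLne, one_mul]
    have e3 : (L : ℝ) * ((c₁ μ : ℝ) + 1 + 1 / L) = L * (c₁ μ : ℝ) + L + 1 := by
      rw [mul_add, mul_add, mul_one, mul_one_div_cancel hLne]
    have e4 : (L : ℝ) * ((c₂ μ : ℝ) - 1 / L) = L * (c₂ μ : ℝ) - 1 := by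
      rw [mul_sub, mul_one_div_cancel hLne]
    rw [a1, e3] at b1'
    rw [a2, e4] at b2'
    have hmul : (L : ℝ) * 2 ≤ L * ((c₂ μ : ℝ) - (c₁ μ : ℝ)) :=
      mul_le_mul_of_nonneg_left (by linarith) hLr.le
    linarith
  have hdist : (L : ℝ) - 2 ≤ dist t₁ t₂ := by
    calc (L : ℝ) - 2 ≤ t₂ μ - t₁ μ := key
      _ ≤ |t₁ μ - t₂ μ| := by rw [abs_sub_comm]; exact le_abs_self _
      _ = dist (t₁ μ) (t₂ μ) := (Real.dist_eq _ _).symm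
      _ ≤ dist t₁ t₂ := dist_le_pi_dist t₁ t₂ μ
  have hρ : (0 : ℝ) < L - 2 := by linarith
  calc (L : ℝ) - 2 ≤ lenIn (Metric.closedBall t₁ ((L : ℝ) - 2)) T := le_lenIn_closedBall hT ht₁ ht₂ hρ hdist
    _ ≤ len T := lenIn_le_len _ T

/-! ## Part 2. Torus complements: the one-point graph, infimum with a constant, □̃ and Z′ through an arbitrary lift -/

/-- The one-point graph at a point q lying in a lift of every cube of the torus family X̄ is admissible for X̄ (length 0)
— torus version of `B13Geometry236.admissible_point`. [folklore] -/
theorem tAdmissible_point {X : Finset (TPt d N)} (hX : X.Nonempty) {q : RPt d}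
    (hq : ∀ c ∈ X, ∃ x : Pt d, proj N x = c ∧ q ∈ cube x) : TAdmissible X [(q, q)] := by
  have hc : carrier [(q, q)] = {q} := by
    simp only [carrier_cons, carrier_nil, Set.union_empty, segment_same]
  refine ⟨?_, ?_, ?_⟩
  · rw [hc]
    exact isConnected_singleton
  · rw [hc, Set.singleton_subset_iff]
    obtain ⟨c, hcX⟩ := hX
    obtain ⟨x, hxc, hqx⟩ := hq c hcX
    exact cube_subset_liftCubes (by rw [hxc]; exact hcX) hqx
  · intro c hcX
    obtain ⟨x, hxc, hqx⟩ := hq c hcX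
    exact ⟨x, hxc, q, by rw [hc]; exact Set.mem_singleton q, hqx⟩

/-- Passing to the infimum with a multiplicative constant, torus version of `B13Geometry236.le_mul_treeLen`: if
`a ≤ K·|T|` for every graph T admissible for X̄ (K ≥ 0, the class non-empty) then `a ≤ K·torusTreeLen X̄`. [folklore] -/
theorem le_mul_torusTreeLen {X : Finset (TPt d N)} {a K : ℝ} (hK : 0 ≤ K) (hne : ∃ T, TAdmissible X T)
    (h : ∀ T, TAdmissible X T → a ≤ K * len T) : a ≤ K * torusTreeLen X := by
  rcases hK.eq_or_lt with rfl | hK'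
  · obtain ⟨T, hT⟩ := hne
    have := h T hT
    rw [zero_mul] at this ⊢
    exact this
  · have h' : a / K ≤ torusTreeLen X := le_torusTreeLen hne fun T hT => by
      rw [div_le_iff₀ hK']
      linarith [h T hT, mul_comm K (len T)]
    rwa [div_le_iff₀ hK', mul_comm] at h'

section Periodic

variable [NeZero N]

/-- □̃ on the torus through an ARBITRARY lift: if x is any lift of the cube ā (not necessarily the standard one used
in the definition of `tblock`), every cube of □̃(ā) is the class of a cube of the window block □̃(x) — the deck
transformations permute the blocks. [folklore] -/
theorem exists_block_lift {a b : TPt d N} {x : Pt d} (hx : proj N x = a) (hb : b ∈ tblock a) :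
    ∃ y ∈ B13ScaleTransfer.block x, proj N y = b := by
  unfold tblock at hb
  rw [Finset.mem_image] at hb
  obtain ⟨y₀, hy₀, rfl⟩ := hb
  obtain ⟨k, hk⟩ := exists_period_of_proj_eq (hx.trans (proj_natLift a).symm)
  rw [hk] at hy₀
  rw [B13ScaleTransfer.mem_block] at hy₀
  refine ⟨y₀ - period N k, B13ScaleTransfer.mem_block.2 fun i => ?_, ?_⟩
  · obtain ⟨h1, h2⟩ := hy₀ i
    simp only [Pi.add_apply, Pi.sub_apply] at h1 h2 ⊢
    exact ⟨by linarith, by linarith⟩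
  · have e : y₀ = (y₀ - period N k) + period N k := by simp
    conv_rhs => rw [e, proj_add_period]

end Periodic

section TwoTori

variable {L N' : ℕ} [NeZero L] [NeZero N']

/-- The cells of Z′ through an arbitrary system of lifts x(ā) of the cubes ā of Z̄: every cell of Z′ = `tclosure L N′ Z`
is the class of the block `coarse L y` of a window cube y ∈ □̃(x(ā)), ā ∈ Z̄. [folklore] -/
theorem exists_lift_of_mem_tclosure {Z : Finset (TPt d (L * N'))} {x : TPt d (L * N') → Pt d}
    (hx : ∀ a ∈ Z, proj (L * N') (x a) = a) {c : TPt d N'} (hc : c ∈ tclosure L N' Z) :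
    ∃ a ∈ Z, ∃ y ∈ B13ScaleTransfer.block (x a), proj N' (coarse L y) = c := by
  unfold tclosure tcollar at hc
  rw [Finset.mem_image] at hc
  obtain ⟨b, hb, rfl⟩ := hc
  rw [Finset.mem_biUnion] at hb
  obtain ⟨a, ha, hba⟩ := hb
  obtain ⟨y, hy, rfl⟩ := exists_block_lift (hx a ha) hba
  exact ⟨a, ha, y, hy, (tcoarse_proj y).symm⟩

/-- The block of a lift of a cube ā ∈ Z̄ is a lift of a cell of Z′ (indeed of the cell tcoarse ā ∈ Z̄.image tcoarse ⊆ Z′). [folklore] -/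
theorem proj_coarse_mem_tclosure {Z : Finset (TPt d (L * N'))} {a : TPt d (L * N')} (ha : a ∈ Z) {x : Pt d}
    (hx : proj (L * N') x = a) : proj N' (coarse L x) ∈ tclosure L N' Z := by
  rw [← tcoarse_proj, hx]
  exact Finset.mem_image_of_mem _ (subset_tcollar Z ha)

/-! ## Part 3. The whisker construction on the torus: an admissible graph for Z′ from one for Z̄ -/

/-- THE CONSTRUCTION ON THE TORUS (`B13Geometry236.exists_admissible_closure` through the covering map): let T be
admissible for the torus localization domain Z̄ (T a connected polygonal graph in the universal cover ℝ^d meeting a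
lift x(ā) of every cube ā ∈ Z̄ at a point P(ā)), |T| ≥ L − 2, L ≥ 3, 0 < r with 4r + 2/L < 1.  Then Z′ has an
admissible graph T′ — the rescaled graph T/L plus one whisker of sup-length ≤ 2r + 1/L at each point of a maximal
2r-separated net of the rescaled points P(ā)/L — with L·|T′| ≤ 3|T| + |T|/(rL): every cell of Z′ lifts to a block
`coarse L y`, y ∈ □̃(x(ā)) (`exists_lift_of_mem_tclosure`), which contains a point within 1/L of P(ā)/L
(`exists_corner_point_of_mem_block`), hence within 2r + 1/L of a net point, hence the whisker endpoint
(`B13Geometry236.snap_mem_cube`). [folklore] -/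
theorem exists_tAdmissible_closure (hL : 3 ≤ L) {Z : Finset (TPt d (L * N'))} {T : List (Seg d)}
    (hT : TAdmissible Z T) {r : ℝ} (hr : 0 < r) (hr1 : 4 * r + 2 / (L : ℝ) < 1)
    (hlen : (L : ℝ) - 2 ≤ len T) :
    ∃ T', TAdmissible (tclosure L N' Z) T' ∧ (L : ℝ) * len T' ≤ 3 * len T + len T / (r * L) := by
  classical
  have hL0 : 0 < L := by omega
  have hLr : (0 : ℝ) < L := by exact_mod_cast hL0
  have hLne : (L : ℝ) ≠ 0 := hLr.ne'
  have hL3 : (3 : ℝ) ≤ L := by exact_mod_cast hL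
  -- lifts met by T and the witness points, with their images under p ↦ p/L
  have hw : ∀ a ∈ Z, ∃ x : Pt d, ∃ w : RPt d, proj (L * N') x = a ∧ w ∈ carrier T ∧ w ∈ cube x := fun a ha => by
    obtain ⟨x, hxa, w, hwT, hwx⟩ := hT.meets a ha
    exact ⟨x, w, hxa, hwT, hwx⟩
  choose! X P hXa hPT hPc using hw
  set p : TPt d (L * N') → RPt d := fun a => (L : ℝ)⁻¹ • P a with hp
  set T₁ : List (Seg d) := T.map (scaleSeg (L : ℝ)⁻¹) with hT₁def
  have hT₁ : TAdmissible (Z.image (tcoarse L N')) T₁ := tAdmissible_scale hT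
  have hlen₁ : len T₁ = (L : ℝ)⁻¹ * len T := len_map_scaleSeg (inv_nonneg.2 hLr.le) T
  have hpT₁ : ∀ a ∈ Z, p a ∈ carrier T₁ := fun a ha => by
    rw [hT₁def, carrier_map_scaleSeg]
    exact Set.mem_image_of_mem _ (hPT a ha)
  have hpc : ∀ a ∈ Z, p a ∈ cube (coarse L (X a)) := fun a ha => smul_mem_cube_coarse hL0 (hPc a ha)
  -- a maximal 2r-separated subfamily S of the rescaled witness points
  obtain ⟨S, hSmem, hSmax⟩ := (Z.powerset.filter fun S : Finset (TPt d (L * N')) =>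
      ∀ a ∈ S, ∀ b ∈ S, a ≠ b → 2 * r < dist (p a) (p b)).exists_max_image Finset.card ⟨∅, by simp⟩
  rw [Finset.mem_filter, Finset.mem_powerset] at hSmem
  obtain ⟨hSZ, hSsep⟩ := hSmem
  have hcover : ∀ z ∈ Z, ∃ s ∈ S, dist (p z) (p s) ≤ 2 * r := by
    intro z hz
    by_cases hzS : z ∈ S
    · exact ⟨z, hzS, by rw [dist_self]; positivity⟩
    by_contra hfar
    push Not at hfar
    have hins : insert z S ∈ Z.powerset.filter fun S : Finset (TPt d (L * N')) =>
        ∀ a ∈ S, ∀ b ∈ S, a ≠ b → 2 * r < dist (p a) (p b) := by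
      rw [Finset.mem_filter, Finset.mem_powerset]
      refine ⟨Finset.insert_subset hz hSZ, ?_⟩
      intro a ha b hb hab
      rw [Finset.mem_insert] at ha hb
      rcases ha with rfl | ha <;> rcases hb with rfl | hb
      · exact absurd rfl hab
      · exact hfar b hb
      · rw [dist_comm]; exact hfar a ha
      · exact hSsep a ha b hb hab
    have hle := hSmax _ hins
    rw [Finset.card_insert_of_notMem hzS] at hle
    omega
  -- the whisker radius R = 2r + 1/L < 1/2 and the whisker endpoints f s
  set R : ℝ := 2 * r + 1 / L with hRdef
  have hR0 : 0 ≤ R := by positivity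
  have h2R : 2 * R < 1 := by
    have e : 2 * R = 4 * r + 2 / L := by rw [hRdef]; ring
    linarith
  set f : TPt d (L * N') → RPt d := fun s => snap R (p s) with hf
  have hfp : ∀ s, dist (p s) (f s) ≤ R := fun s => by
    rw [dist_comm]
    exact dist_snap_le hR0 (p s)
  have hfc : ∀ s ∈ Z, f s ∈ cube (coarse L (X s)) := fun s hs =>
    snap_mem_cube h2R (hpc s hs) (by rw [dist_self]; exact hR0)
  -- the whiskers
  set W : List (Seg d) := S.toList.map fun s => (p s, f s) with hWdef
  have hWmem : ∀ sg ∈ W, ∃ s ∈ S, sg = (p s, f s) := fun sg hsg => by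
    rw [hWdef, List.mem_map] at hsg
    obtain ⟨s, hs, rfl⟩ := hsg
    exact ⟨s, Finset.mem_toList.1 hs, rfl⟩
  have hmemW : ∀ s ∈ S, (p s, f s) ∈ W := fun s hs => by
    rw [hWdef, List.mem_map]
    exact ⟨s, Finset.mem_toList.2 hs, rfl⟩
  have hlenW : len W ≤ (S.card : ℝ) * R := by
    have := len_map_le S.toList (fun s => (p s, f s)) (fun s _ => hfp s)
    rwa [Finset.length_toList] at this
  refine ⟨T₁ ++ W, ⟨?_, ?_, ?_⟩, ?_⟩
  · -- connected: each whisker hangs at a point p s of T₁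
    rw [carrier_append]
    exact isConnected_union_carrier hT₁.connected W fun sg hsg => by
      obtain ⟨s, hs, rfl⟩ := hWmem sg hsg
      exact hpT₁ s (hSZ hs)
  · -- contained in the lifts of the cells of Z′
    rw [carrier_append]
    refine Set.union_subset
      (hT₁.subset.trans (liftCubes_mono (Finset.image_subset_image (subset_tcollar Z)))) ?_
    intro x hx
    obtain ⟨sg, hsg, hx⟩ := mem_carrier.1 hx
    obtain ⟨s, hs, rfl⟩ := hWmem sg hsg
    have hsZ : s ∈ Z := hSZ hs
    exact cube_subset_liftCubes (proj_coarse_mem_tclosure hsZ (hXa s hsZ))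
      ((convex_cube _).segment_subset (hpc s hsZ) (hfc s hsZ) hx)
  · -- meets a lift of every cell of Z′: the lifted cell contains a point within R of a net point p s, hence f s
    intro c hc
    obtain ⟨z, hz, y, hy, hyc⟩ := exists_lift_of_mem_tclosure hXa hc
    obtain ⟨q, hqc, hq⟩ := exists_corner_point_of_mem_block hL0 hy
    obtain ⟨s, hs, hzs⟩ := hcover z hz
    have hqs : dist q (p s) ≤ R := by
      calc dist q (p s) ≤ dist q (p z) + dist (p z) (p s) := dist_triangle _ _ _
        _ ≤ 1 / L + 2 * r := add_le_add (hq (P z) (hPc z hz)) hzs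
        _ = R := by rw [hRdef]; ring
    refine ⟨coarse L y, hyc, f s, ?_, snap_mem_cube h2R hqc hqs⟩
    rw [carrier_append]
    exact Or.inr (mem_carrier.2 ⟨(p s, f s), hmemW s hs, right_mem_segment ℝ (p s) (f s)⟩)
  · -- the length accounting (verbatim from the window construction)
    rw [len_append, hlen₁]
    have e1 : (L : ℝ) * ((L : ℝ)⁻¹ * len T + len W) = len T + L * len W := by
      rw [mul_add, ← mul_assoc, mul_inv_cancel₀ hLne, one_mul]
    rw [e1]
    have hLW : (L : ℝ) * len W ≤ 2 * ((S.card : ℝ) * (r * L)) + S.card := by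
      calc (L : ℝ) * len W ≤ L * ((S.card : ℝ) * R) := mul_le_mul_of_nonneg_left hlenW hLr.le
        _ = 2 * ((S.card : ℝ) * (r * L)) + S.card := by
          rw [hRdef]
          field_simp
    have hrL : 0 < r * L := mul_pos hr hLr
    have hnn : 0 ≤ len T / (r * L) := div_nonneg (len_nonneg T) hrL.le
    rcases Nat.lt_or_ge 1 S.card with h1 | h1
    · -- two or more whiskers: the disjoint balls B̄(p s, r), s ∈ S, each capture length ≥ r of T₁
      have hcap : ∀ s ∈ S, r ≤ lenIn (Metric.closedBall (p s) r) T₁ := by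
        intro s hs
        obtain ⟨s', hs', hne⟩ := (Finset.one_lt_card_iff_nontrivial.1 h1).exists_ne s
        have hfar : r ≤ dist (p s) (p s') := by
          have := hSsep s hs s' hs' hne.symm
          linarith
        exact le_lenIn_closedBall hT₁.connected.isPreconnected (hpT₁ s (hSZ hs)) (hpT₁ s' (hSZ hs')) hr hfar
      have hdisj : (S : Set (TPt d (L * N'))).PairwiseDisjoint (fun s => Metric.closedBall (p s) r) := by
        intro a ha b hb hab
        exact Metric.closedBall_disjoint_closedBall (by have := hSsep a ha b hb hab; linarith)
      have hsum : (S.card : ℝ) * r ≤ len T₁ := by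
        calc (S.card : ℝ) * r = ∑ s ∈ S, r := by rw [Finset.sum_const, nsmul_eq_mul]
          _ ≤ ∑ s ∈ S, lenIn (Metric.closedBall (p s) r) T₁ := Finset.sum_le_sum hcap
          _ ≤ len T₁ := sum_lenIn_le_len S _ (fun s _ => Metric.isClosed_closedBall) hdisj T₁
      rw [hlen₁] at hsum
      have hS : (S.card : ℝ) * (r * L) ≤ len T := by
        have h2 := mul_le_mul_of_nonneg_right hsum hLr.le
        have e2 : (L : ℝ)⁻¹ * len T * L = len T := by
          field_simp
        calc (S.card : ℝ) * (r * L) = (S.card : ℝ) * r * L := by ring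
          _ ≤ (L : ℝ)⁻¹ * len T * L := h2
          _ = len T := e2
      have hS' : (S.card : ℝ) ≤ len T / (r * L) := by
        rw [le_div_iff₀ hrL]
        exact hS
      linarith
    · -- at most one whisker: its cost 2rL + 1 < L/2 ≤ 2|T| since |T| ≥ L − 2
      have hc1 : (S.card : ℝ) ≤ 1 := by exact_mod_cast h1
      have h4 : 4 * (r * L) + 2 < L := by
        have h5 := mul_lt_mul_of_pos_right hr1 hLr
        have e : (4 * r + 2 / L) * (L : ℝ) = 4 * (r * L) + 2 := by
          field_simp
        rwa [e, one_mul] at h5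
      have h5 : (S.card : ℝ) * (r * L) ≤ r * L := by
        have := mul_le_mul_of_nonneg_right hc1 hrL.le
        rwa [one_mul] at this
      linarith

/-! ## Part 4. The theorem on the torus: L·d_{k+1}(Z′) ≤ (3 + 4/(L − 2))·d_k(Z̄), every d, every L ≥ 3, L ∣ N -/

/-- THE DICHOTOMY, per admissible graph (torus form of GEOMETRY-236.md Lemma 1 + Theorem A): for T admissible for Z̄,
L ≥ 3 and every net radius ρ with 4ρ + 2 < L, `L · torusTreeLen Z′ ≤ (3 + 1/ρ)·|T|` — EITHER two lifted cells
`coarse L y`, y ∈ □̃(x(ā)), are ≥ 2 apart in some coordinate, then |T| ≥ L − 2 (`sub_two_le_len_of_points`) and the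
whisker construction applies (`exists_tAdmissible_closure` with r = ρ/L), OR all lifted cells pairwise touch, have a
common point (`B13Geometry236.exists_common_point`) and the one-point graph gives torusTreeLen Z′ = 0. [folklore] -/
theorem mul_torusTreeLen_tclosure_le (hL : 3 ≤ L) {Z : Finset (TPt d (L * N'))} (hZ : Z.Nonempty)
    {T : List (Seg d)} (hT : TAdmissible Z T) {ρ : ℝ} (hρ : 0 < ρ) (hρL : 4 * ρ + 2 < L) :
    (L : ℝ) * torusTreeLen (tclosure L N' Z) ≤ (3 + 1 / ρ) * len T := by
  classical
  have hL0 : 0 < L := by omega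
  have hLr : (0 : ℝ) < L := by exact_mod_cast hL0
  have hK : (0 : ℝ) ≤ 3 + 1 / ρ := by positivity
  -- lifts met by T and the witness points
  have hw : ∀ a ∈ Z, ∃ x : Pt d, ∃ w : RPt d, proj (L * N') x = a ∧ w ∈ carrier T ∧ w ∈ cube x := fun a ha => by
    obtain ⟨x, hxa, w, hwT, hwx⟩ := hT.meets a ha
    exact ⟨x, w, hxa, hwT, hwx⟩
  choose! X P hXa hPT hPc using hw
  by_cases hfar : ∃ a₁ ∈ Z, ∃ y₁ ∈ B13ScaleTransfer.block (X a₁), ∃ a₂ ∈ Z,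
      ∃ y₂ ∈ B13ScaleTransfer.block (X a₂), ∃ μ : Fin d, coarse L y₁ μ + 2 ≤ coarse L y₂ μ
  · -- two lifted cells two scales apart: |T| ≥ L − 2 and the whisker construction
    obtain ⟨a₁, ha₁, y₁, hy₁, a₂, ha₂, y₂, hy₂, μ, hμ⟩ := hfar
    obtain ⟨q₁, hq₁, h₁⟩ := exists_corner_point_of_mem_block hL0 hy₁
    obtain ⟨q₂, hq₂, h₂⟩ := exists_corner_point_of_mem_block hL0 hy₂
    have hlen : (L : ℝ) - 2 ≤ len T :=
      sub_two_le_len_of_points hL hT.connected.isPreconnected (hPT a₁ ha₁) (hPT a₂ ha₂) hq₁ hq₂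
        (h₁ (P a₁) (hPc a₁ ha₁)) (h₂ (P a₂) (hPc a₂ ha₂)) hμ
    have hr1 : 4 * (ρ / L) + 2 / (L : ℝ) < 1 := by
      have e : 4 * (ρ / L) + 2 / (L : ℝ) = (4 * ρ + 2) / L := by ring
      rw [e, div_lt_one hLr]
      exact hρL
    obtain ⟨T', hT', hb⟩ := exists_tAdmissible_closure hL hT (div_pos hρ hLr) hr1 hlen
    have e : ρ / L * L = ρ := by field_simp
    rw [e] at hb
    calc (L : ℝ) * torusTreeLen (tclosure L N' Z) ≤ L * len T' :=
          mul_le_mul_of_nonneg_left (torusTreeLen_le_len hT') hLr.le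
      _ ≤ 3 * len T + len T / ρ := hb
      _ = (3 + 1 / ρ) * len T := by ring
  · -- all lifted cells pairwise touch: a common point, the one-point graph, torusTreeLen Z′ = 0
    push Not at hfar
    set Y : Finset (Pt d) := Z.biUnion fun a => (B13ScaleTransfer.block (X a)).image (coarse L) with hYdef
    have hmemY : ∀ {c : Pt d}, c ∈ Y ↔ ∃ a ∈ Z, ∃ y ∈ B13ScaleTransfer.block (X a), coarse L y = c := by
      intro c
      rw [hYdef, Finset.mem_biUnion]
      simp only [Finset.mem_image]
    obtain ⟨a₀, ha₀⟩ := hZ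
    have hY : Y.Nonempty := ⟨coarse L (X a₀), hmemY.2 ⟨a₀, ha₀, X a₀, B13ScaleTransfer.mem_block_self _, rfl⟩⟩
    have htouch : ∀ c₁ ∈ Y, ∀ c₂ ∈ Y, ∀ μ, c₂ μ ≤ c₁ μ + 1 := by
      intro c₁ hc₁ c₂ hc₂ μ
      obtain ⟨a₁, ha₁, y₁, hy₁, rfl⟩ := hmemY.1 hc₁
      obtain ⟨a₂, ha₂, y₂, hy₂, rfl⟩ := hmemY.1 hc₂
      have := hfar a₁ ha₁ y₁ hy₁ a₂ ha₂ y₂ hy₂ μ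
      omega
    obtain ⟨q, hq⟩ := exists_common_point hY htouch
    have hne' : (tclosure L N' Z).Nonempty := tclosure_nonempty ⟨a₀, ha₀⟩
    have hadm : TAdmissible (tclosure L N' Z) [(q, q)] := by
      refine tAdmissible_point hne' fun c hc => ?_
      obtain ⟨a, ha, y, hy, hyc⟩ := exists_lift_of_mem_tclosure hXa hc
      exact ⟨coarse L y, hyc, hq _ (hmemY.2 ⟨a, ha, y, hy, rfl⟩)⟩
    have h0 : torusTreeLen (tclosure L N' Z) ≤ 0 := by
      have := torusTreeLen_le_len hadm
      simpa using this
    calc (L : ℝ) * torusTreeLen (tclosure L N' Z) ≤ L * 0 := mul_le_mul_of_nonneg_left h0 hLr.le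
      _ = 0 := mul_zero _
      _ ≤ (3 + 1 / ρ) * len T := mul_nonneg hK (len_nonneg T)

/-- THE CERTIFIED SUBSTITUTE FOR (2.36) p. 19 PROVED ON THE TORUS, under L ∣ N: for every dimension d, every L ≥ 3,
every N′ ≥ 1 and every localization domain Z̄ of the torus with L·N′ cubes of π_k per direction, with Z′ = the cubes
of π_{k+1} (N′ per direction, SAME torus) met by Z̃,
  `L · torusTreeLen Z′ ≤ (3 + 4/(L − 2)) · torusTreeLen Z̄`
— the torus twin of `B13Geometry236.geometry236_treeLen` (window carrier), against the printed, unproved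
`L · d_{k+1}(Z′) ≤ 2 · d_k(Z)` (cell GAPS.md G-B13-09). [cite: Balaban1988RG2Cluster, (2.36) p.19] -/
theorem geometry236_torusTreeLen (hL : 3 ≤ L) {Z : Finset (TPt d (L * N'))} (hZ : Z.Nonempty)
    (hc : TFaceConnected Z) :
    (L : ℝ) * torusTreeLen (tclosure L N' Z) ≤ (3 + 4 / ((L : ℝ) - 2)) * torusTreeLen Z := by
  have hL0 : 0 < L := by omega
  have hLr : (0 : ℝ) < L := by exact_mod_cast hL0
  have hL3 : (3 : ℝ) ≤ L := by exact_mod_cast hL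
  have hL2 : (0 : ℝ) < L - 2 := by linarith
  have htl0 : 0 ≤ torusTreeLen Z := torusTreeLen_nonneg Z
  have hne : ∃ T, TAdmissible Z T := (exists_tAdmissible hZ hc).imp fun T h => h.1
  -- for every net radius ρ < (L − 2)/4:  L·torusTreeLen Z′ ≤ (3 + 1/ρ)·torusTreeLen Z̄
  have key : ∀ ρ : ℝ, 0 < ρ → 4 * ρ + 2 < L →
      (L : ℝ) * torusTreeLen (tclosure L N' Z) ≤ (3 + 1 / ρ) * torusTreeLen Z := fun ρ hρ hρL =>
    le_mul_torusTreeLen (by positivity) hne fun T hT => mul_torusTreeLen_tclosure_le hL hZ hT hρ hρL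
  rcases htl0.eq_or_lt with h0 | hpos
  · -- torusTreeLen Z̄ = 0
    have h := key (((L : ℝ) - 2) / 8) (by positivity) (by linarith)
    rw [← h0, mul_zero] at h
    rw [← h0, mul_zero]
    exact h
  · -- torusTreeLen Z̄ > 0: let ρ ↑ (L − 2)/4
    refine le_of_forall_pos_le_add fun ε hε => ?_
    set A : ℝ := 4 / ((L : ℝ) - 2) with hA
    have hA0 : 0 < A := by positivity
    have hB0 : 0 < ε / torusTreeLen Z := div_pos hε hpos
    have hρ : 0 < 1 / (A + ε / torusTreeLen Z) := by positivity
    have hρL : 4 * (1 / (A + ε / torusTreeLen Z)) + 2 < L := by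
      have h1 : 1 / (A + ε / torusTreeLen Z) < 1 / A := one_div_lt_one_div_of_lt hA0 (by linarith)
      have h2 : 1 / A = ((L : ℝ) - 2) / 4 := by rw [hA, one_div_div]
      linarith
    have h := key _ hρ hρL
    rw [one_div_one_div] at h
    have e : ε / torusTreeLen Z * torusTreeLen Z = ε := by field_simp
    calc (L : ℝ) * torusTreeLen (tclosure L N' Z) ≤ (3 + (A + ε / torusTreeLen Z)) * torusTreeLen Z := h
      _ = (3 + A) * torusTreeLen Z + ε / torusTreeLen Z * torusTreeLen Z := by ring
      _ = (3 + A) * torusTreeLen Z + ε := by rw [e]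

/-- The same with the named constant a(L) = `B13Geometry236.a236 L` = 3 + 4/(L − 2):
L · d_{k+1}(Z′) ≤ a(L) · d_k(Z̄) on the torus. [cite: Balaban1988RG2Cluster, (2.36) p.19] -/
theorem geometry236_torusTreeLen_a236 (hL : 3 ≤ L) {Z : Finset (TPt d (L * N'))} (hZ : Z.Nonempty)
    (hc : TFaceConnected Z) :
    (L : ℝ) * torusTreeLen (tclosure L N' Z) ≤ a236 L * torusTreeLen Z := by
  unfold a236
  exact geometry236_torusTreeLen hL hZ hc

/-- d = 4, L = 13 (the least block size admitted by [Balaban1987RG1] p. 251): 13 · d_{k+1}(Z′) ≤ (37/11) · d_k(Z̄) for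
every localization domain Z̄ of the four-dimensional torus with 13·N′ cubes per direction (window twin
`B13Geometry236.geometry236_thirteen`). [cite: Balaban1988RG2Cluster, (2.36) p.19] -/
theorem geometry236_torus_thirteen {Z : Finset (TPt 4 (13 * N'))} (hZ : Z.Nonempty)
    (hc : TFaceConnected Z) :
    (13 : ℝ) * torusTreeLen (tclosure 13 N' Z) ≤ 37 / 11 * torusTreeLen Z := by
  have h := geometry236_torusTreeLen (d := 4) (L := 13) (N' := N') (by norm_num) hZ hc
  norm_num at h
  linarith

/-- The exponential form used on pp. 19–20 ((2.36) ⇒ (2.37), verbatim p. 20: *"(1 − 5δ)κd_k(Z_i) in the exponentials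
replaced by (1 − 6δ)½Lκd_{k+1}(Z′_i)"*, here with L/a(L) in place of ½L and no constant), on the torus: for every rate
c ≥ 0, `exp(−c·d_k(Z̄)) ≤ exp(−c·(L/a(L))·d_{k+1}(Z′))`. [cite: Balaban1988RG2Cluster, p.20 (after (2.36))] -/
theorem exp_transfer_torus_geometry (hL : 3 ≤ L) {Z : Finset (TPt d (L * N'))} (hZ : Z.Nonempty)
    (hc : TFaceConnected Z) {c : ℝ} (hc0 : 0 ≤ c) :
    Real.exp (-(c * torusTreeLen Z)) ≤
      Real.exp (-(c * ((L : ℝ) / a236 L) * torusTreeLen (tclosure L N' Z))) := by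
  have hL3 : (3 : ℝ) ≤ L := by exact_mod_cast hL
  have ha : 0 < a236 (L : ℝ) := a236_pos (by linarith)
  have h := geometry236_torusTreeLen_a236 hL hZ hc
  have h' : (L : ℝ) / a236 L * torusTreeLen (tclosure L N' Z) ≤ torusTreeLen Z := by
    rw [div_mul_eq_mul_div, div_le_iff₀ ha]
    calc (L : ℝ) * torusTreeLen (tclosure L N' Z) ≤ a236 L * torusTreeLen Z := h
      _ = torusTreeLen Z * a236 L := mul_comm _ _
  apply Real.exp_le_exp.mpr
  have := mul_le_mul_of_nonneg_left h' hc0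
  rw [← mul_assoc] at this
  linarith

/-! ## Part 5. (2.36)_ℓ for the torus catalogues: `B13.Ineq236With (tsys d (L·N′)) (tsys d N′) (Z ↦ Z′) (L/a(L))` -/

variable (L N')

/-- (2.36)_ℓ AS A THEOREM ON THE PAPERS' PERIODIC CARRIER: for the torus catalogues `tsys d (L·N′)` (𝐃_k: L·N′ cubes of
π_k per direction, d_k := `torusTreeLen`) and `tsys d N′` (𝐃_{k+1}: N′ cubes of π_{k+1} per direction of the SAME
torus) and the closure map Z ↦ Z′ (`tclosureDom L N′`), b13's transfer hypothesis
`B13.Ineq236With (tsys d (L·N′)) (tsys d N′) (tclosureDom L N′) ℓ` HOLDS with ℓ = L / a236 L, for every d, every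
L ≥ 3 and every N′ ≥ 1 — the input of `B13.exp_transfer_of_ineq236With` (the ℓ of `B13.Lemma3With`,
`B13.Consts.R22gen`, `B13.deliverables_of_chainWith`) supplied on the torus by a kernel theorem instead of the
printed, unproved ℓ = ½L; ℓ > 1 for every L ≥ 5 (`B13Geometry236.one_lt_transferFactor`), in particular for every L
admitted by [Balaban1987RG1] p. 251 (*"L is an odd, positive integer > 11"*). [cite: Balaban1988RG2Cluster, (2.36) p.19] -/
theorem ineq236With_torus (hL : 3 ≤ L) :
    B13.Ineq236With (tsys d (L * N')) (tsys d N') (tclosureDom L N') ((L : ℝ) / a236 L) := by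
  have hL3 : (3 : ℝ) ≤ L := by exact_mod_cast hL
  refine B13.ineq236With_of_pointwise (a236_pos (by linarith)) fun X => ?_
  show (L : ℝ) * torusTreeLen (tclosure L N' X.1) ≤ a236 L * torusTreeLen X.1
  exact geometry236_torusTreeLen_a236 hL X.2.1 X.2.2

/-- … and with the prose constant of GEOMETRY-236.md / `B13.Consts.aL L` = 3 + 12/(L − 2) (weaker, by
`B13Geometry236.a236_le_aL`): `B13.Ineq236With (tsys d (L·N′)) (tsys d N′) (tclosureDom L N′) (L / B13.Consts.aL L)`.
[cite: Balaban1988RG2Cluster, (2.36) p.19] -/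
theorem ineq236With_torus_aL (hL : 3 ≤ L) :
    B13.Ineq236With (tsys d (L * N')) (tsys d N') (tclosureDom L N') ((L : ℝ) / B13.Consts.aL L) := by
  have hL3 : (3 : ℝ) ≤ L := by exact_mod_cast hL
  have haL : a236 (L : ℝ) ≤ B13.Consts.aL L := a236_le_aL (by linarith)
  have ha : 0 < B13.Consts.aL (L : ℝ) := (a236_pos (by linarith)).trans_le haL
  refine B13.ineq236With_of_pointwise ha fun X => ?_
  show (L : ℝ) * torusTreeLen (tclosure L N' X.1) ≤ B13.Consts.aL L * torusTreeLen X.1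
  exact (geometry236_torusTreeLen_a236 hL X.2.1 X.2.2).trans
    (mul_le_mul_of_nonneg_right haL (torusTreeLen_nonneg _))

/-- The single printed USE of the transfer (p. 20 ll. 2–3, `B13.exp_transfer_of_ineq236With`) on the torus catalogues: for every rate
r ≥ 0 and every Z ∈ 𝐃_k of the fine torus, exp(−r·d_k(Z)) ≤ exp(−r·(L/a(L))·d_{k+1}(Z′)). [cite: Balaban1988RG2Cluster, p.20 (after (2.36))] -/
theorem exp_transfer_tsys (hL : 3 ≤ L) {r : ℝ} (hr : 0 ≤ r) (Z : (tsys d (L * N')).Dom) :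
    Real.exp (-(r * (tsys d (L * N')).dj Z)) ≤
      Real.exp (-(r * ((L : ℝ) / a236 L) * (tsys d N').dj (tclosureDom L N' Z))) :=
  B13.exp_transfer_of_ineq236With (ineq236With_torus L N' hL) r hr Z

/-- d = 4, L = 13 (the least admitted block size; N = 13·N′): the transfer inequality between the torus catalogues holds
with ℓ = 13/a(13) = 143/37 = 3.86… (`B13Geometry236.transferFactor_thirteen`; printed ½L = 6.5). [cite: Balaban1988RG2Cluster, (2.36) p.19] -/
theorem ineq236With_torus_thirteen (N' : ℕ) [NeZero N'] :
    B13.Ineq236With (tsys 4 (13 * N')) (tsys 4 N') (tclosureDom 13 N') (143 / 37) := by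
  have h := ineq236With_torus (d := 4) 13 N' (by norm_num)
  have e : ((13 : ℕ) : ℝ) / a236 ((13 : ℕ) : ℝ) = 143 / 37 := by
    rw [show ((13 : ℕ) : ℝ) = 13 by norm_num, transferFactor_thirteen]
  rwa [e] at h

end TwoTori

end

end Literature.MathematicalPhysics.QuantumFieldTheory.Balaban1983to89.TreeLengthTorusGeometry236
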